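import Literature.Computability.Cryptography.QuantumCircuitDescFP
import Literature.Computability.Complexity.ListFoldBricks
import Literature.Computability.Complexity.FoldBricks
import Literature.Computability.Complexity.PlumbingBricks
import HarnessLib

/-!
# The number of oracle gates of a uniform quantum circuit family is polynomial-time computable

Topic `Literature/Computability/Cryptography` (the circuit model of `QuantumCircuit.lean`; sequel of
`QuantumCircuitDescFP.lean`, which gives the description function `QCircuitFamily.descFn` of a uniform
family, `z ↦ ⟨bin |z|, ⟨1^{anc |z|}, encode (circ |z|)⟩⟩`, as an `FP` string function). Constructions
that simulate or post-process a uniform family `F` WITH ORACLE GATES need its number of queries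
`T(n) = (F.circ n).oracleQueries` as a polynomial-time function of `n` — e.g. the hybrid / BBBV estimates
`4T²`, `2T`-wise independent hash families replacing a random oracle (Zhandry), or thresholds
`w(n, T(n))` of promise problems built from `F` (Aaronson–Ambainis, proof of Thm. 23). In a P-uniform
family the description of `F.circ n` is printed in time `poly(n)` (Arora–Barak 2009, §6.2 Def. 6.12,
Remark 6.7), and counting the oracle gates in it is one pass over the gate codes:

* `QGate.bitsToNat_take_one_encode` — the first bit of a gate code is its ORACLE TAG (`QGate.encode`:
  `0…` for a gate symbol, `1…` for an oracle query), read as the numeral `0`/`1`;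
* `QCircuitFamily.oracleCountStep`, **`QCircuitFamily.oracleCountFn F`** — the fold
  (`Brick.foldFn`, `ListFoldBricks.lean`) of "add the tag bit of the item to the accumulator" over the
  coded gate list `encode (F.circ |z|) = encList (gate codes)` read off `F.descFn z`;
  **`oracleCountFn_apply`**: `F.oracleCountFn z = encodeNat (F.circ |z|).oracleQueries` on EVERY input `z`,
  and **`oracleCountFn_mem_FP`**: it is in `FP` when `F` is uniform.

Everything here is PROVED (two definitions with bodies: the step and the function).

## References

* S. Arora, B. Barak, *Computational Complexity: A Modern Approach*, CUP 2009, §6.2 (Def. 6.12,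
  Thm. 6.13, Remark 6.7: P-uniform families, descriptions printed with counters), §1.3 (bounded loops)
  [AroraBarak2009].
* C. H. Bennett, E. Bernstein, G. Brassard, U. Vazirani, *Strengths and weaknesses of quantum computing*,
  SIAM J. Comput. 26 (1997), §3 (the number `T` of queries of an oracle machine as the resource)
  [BennettBernsteinBrassardVazirani1997].
-/

noncomputable section

namespace Literature.Computability.Cryptography

open _root_.Computability Complexity Complexity.Brick Plumb

variable {G : QGateSet} [Encodable G.Op]

/-! ### The oracle tag of a gate code -/

namespace QGate

/-- **The first bit of a gate code is the oracle tag**, as a numeral: `⟦(encode g).take 1⟧ = 0` for a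
gate symbol and `= 1` for an oracle query. [cite: AroraBarak2009, §6.1 (descriptions of circuits: gate type tags)] -/
theorem bitsToNat_take_one_encode {n : ℕ} (g : QGate G n) :
    bitsToNat (g.encode.take 1) = if g.IsOracleFree then 0 else 1 := by
  cases g with
  | gate g e => simp [QGate.encode, QGate.IsOracleFree]
  | oracle k e => simp [QGate.encode, QGate.IsOracleFree]

end QGate

namespace QCircuitFamily

/-! ### The counting fold -/

/-- The fold step on records `⟨u, ⟨a, acc⟩⟩` (`a` the current gate code, `acc` the running count in
binary): `encodeNat (⟦acc⟧ + ⟦a.take 1⟧)` — add the oracle tag of the item.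
[cite: AroraBarak2009, §1.3 (bounded loops in polynomial time)] -/
def oracleCountStep : List Bool → List Bool :=
  addFn ∘ fanoutFn (sndF ∘ sndF) (takeFn ∘ fanoutFn (fun _ => [true]) (fstF ∘ sndF))

/-- Value of the step on a record. [cite: AroraBarak2009, §1.3 (bounded loops in polynomial time)] -/
@[simp] theorem oracleCountStep_apply (u a acc : List Bool) :
    oracleCountStep (boolPair u (boolPair a acc)) = encodeNat (bitsToNat acc + bitsToNat (a.take 1)) := by
  simp [oracleCountStep, fanoutFn_apply, takeFn_boolPair]

/-- Value of the step on an arbitrary string (total form). [cite: AroraBarak2009, §1.3 (bounded loops in polynomial time)] -/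
theorem oracleCountStep_eq (v : List Bool) :
    oracleCountStep v = encodeNat (bitsToNat (sndF (sndF v)) + bitsToNat ((fstF (sndF v)).take 1)) := by
  simp [oracleCountStep, fanoutFn_apply, takeFn_boolPair]

/-- `oracleCountStep ∈ FP`. [cite: AroraBarak2009, §1.3] -/
theorem oracleCountStep_mem_FP : oracleCountStep ∈ FP :=
  comp_mem_FP addFn_mem_FP (fanoutFn_mem_FP (comp_mem_FP sndF_mem_FP sndF_mem_FP)
    (comp_mem_FP takeFn_mem_FP (fanoutFn_mem_FP (const_mem_FP _) (comp_mem_FP fstF_mem_FP sndF_mem_FP))))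

/-- The step grows the accumulator by at most one carry symbol plus the tag: `FoldGrowth 1`.
[cite: AroraBarak2009, §1.3] -/
theorem foldGrowth_oracleCountStep : FoldGrowth 1 oracleCountStep := by
  intro v
  rw [oracleCountStep_eq]
  have h := length_encodeNat_add_le (sndF (sndF v)) ((fstF (sndF v)).take 1)
  have ht : ((fstF (sndF v)).take 1).length ≤ (fstF (sndF v)).length := List.length_take_le' _ _
  omega

/-- The fold over a list of gate codes counts the oracle gates (from any starting count `m`).
[cite: AroraBarak2009, §6.1 (descriptions of circuits)] -/
theorem foldl_oracleCountStep {n : ℕ} (w : List Bool) :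
    ∀ (gs : List (QGate G n)) (m : ℕ),
      (gs.map QGate.encode).foldl (fun acc a => oracleCountStep (boolPair w (boolPair a acc))) (encodeNat m) =
        encodeNat (m + (gs.filter fun g => ¬ g.IsOracleFree).length)
  | [], m => by simp
  | g :: gs, m => by
    rw [List.map_cons, List.foldl_cons, oracleCountStep_apply, bitsToNat_encodeNat,
      QGate.bitsToNat_take_one_encode]
    by_cases hg : g.IsOracleFree
    · rw [if_pos hg, Nat.add_zero, foldl_oracleCountStep w gs m, List.filter_cons_of_neg (by simpa using hg)]
    · rw [if_neg hg, foldl_oracleCountStep w gs (m + 1), List.filter_cons_of_pos (by simpa using hg),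
        List.length_cons]
      congr 1
      omega

/-! ### The oracle-count function -/

/-- **The number of oracle gates as a string function**: on input `z`, read the coded gate list of
`F.circ |z|` off the description `F.descFn z` and fold `oracleCountStep` over it from `bin 0`.
[cite: AroraBarak2009, §6.2 Remark 6.7 (descriptions printed by the uniformity machine)] -/
def oracleCountFn (F : QCircuitFamily G) : List Bool → List Bool :=
  foldFn oracleCountStep (fun _ => encodeNat 0) ∘ sndF ∘ F.descFn

/-- **Value on every input**: `F.oracleCountFn z = bin T(|z|)`, `T(n) = (F.circ n).oracleQueries`.
[cite: BennettBernsteinBrassardVazirani1997, §3 (the number T of oracle queries)] -/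
theorem oracleCountFn_apply (F : QCircuitFamily G) (z : List Bool) :
    F.oracleCountFn z = encodeNat (F.circ z.length).oracleQueries := by
  simp only [oracleCountFn, Function.comp_apply, descFn_eq, sndF_boolPair]
  rw [foldFn_boolPair, QCircuit.encode_eq_encList, decNil_encList, foldl_oracleCountStep, Nat.zero_add]
  rfl

/-- **The oracle count of a uniform family is polynomial-time computable.**
[cite: AroraBarak2009, §6.2 Def. 6.12 and Remark 6.7] -/
theorem oracleCountFn_mem_FP {F : QCircuitFamily G} (hU : F.IsUniform) : F.oracleCountFn ∈ FP :=
  comp_mem_FP (foldFn_mem_FP oracleCountStep_mem_FP (const_mem_FP _) foldGrowth_oracleCountStep)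
    (comp_mem_FP sndF_mem_FP (descFn_mem_FP_of_isUniform hU))

/-- Packaged: a uniform family has an `FP` function printing its oracle count in binary on every input
of the given length. [cite: AroraBarak2009, §6.2 Def. 6.12 and Remark 6.7] -/
theorem exists_oracleCount_mem_FP {F : QCircuitFamily G} (hU : F.IsUniform) :
    ∃ f : List Bool → List Bool, f ∈ FP ∧ ∀ z : List Bool, f z = encodeNat (F.circ z.length).oracleQueries :=
  ⟨F.oracleCountFn, oracleCountFn_mem_FP hU, oracleCountFn_apply F⟩

end QCircuitFamily

end Literature.Computability.Cryptography

end
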